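import Mathlib
import HarnessLib
import Literature.Probability.MarkovChains.RelaxationTime
import Literature.Probability.MarkovChains.ConvergenceTheorem

/-!
# `γ⋆ > 0` for an irreducible aperiodic chain: every eigenvalue `λ ≠ 1` has `|λ| < 1`; Lemma 12.1 (iii) (`−1` is not an eigenvalue) (Levin–Peres–Wilmer §12.1–12.2)

HONEST FRAMING: exact (Metropolis-corrected) sampling algorithms for lattice gauge theory; figures
of merit are autocorrelation/cost numbers at stated couplings and volumes; no continuum-physics claim.

Conventions of `TotalVariation.lean` (`IsRowStochastic`), `PeskunOrdering.lean` (`IsIrreducible`),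
`ConvergenceTheorem.lean` (`IsAperiodic`, Prop. 1.7 `LevinPeres2017_prop_1_7`: `Pʳ(x,y) > 0` for all
`x, y` and all large `r`), `RelaxationTimeLowerBound.lean` (`norm_eigenvalue_le_one` = Lemma 12.1 (i),
`hasEigenvector_iff`) and `RelaxationTime.lean` (`nontrivialEigenvalues P`, `lambdaStar P = λ⋆`,
`absSpectralGap P = γ⋆ = 1 − λ⋆`, `relaxationTime P = t_rel = 1/γ⋆`).  Source: D. A. Levin, Y. Peres
(with E. L. Wilmer), *Markov Chains and Mixing Times*, 2nd ed., AMS 2017 [LevinPeres2017], §12.1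
Lemma 12.1 p. 161 and §12.2 p. 163.  Everything is PROVED (0 named facts).

* `sum_pow_mul_eigenfunction` — `Pʳf = λʳf` entrywise for a complex eigenfunction
  [cite: LevinPeres2017, §12.1 (`Pᵗf_j = λ_jᵗ f_j`)];
* **`norm_lt_one_of_eigenvalue_ne_one`** — for a row-stochastic, irreducible and aperiodic `P`,
  **every (complex) eigenvalue `λ ≠ 1` has `|λ| < 1`** [cite: LevinPeres2017, §12.2 p. 163 ("Lemma
  12.1 implies that if `P` is aperiodic and irreducible, then `γ⋆ > 0`") with §12.1 Lemma 12.1 and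
  §1.3 Prop. 1.7].  Proof (the maximum-modulus argument of Lemma 12.1 (i) / Exercise 12.1, run on a
  power `Pʳ` with all entries positive, Prop. 1.7): at a maximiser `x` of `|f|`, `|λ| = 1` forces
  equality in `|λʳ f(x)| = |Σ_y Pʳ(x,y) f(y)| ≤ Σ_y Pʳ(x,y)|f(y)| ≤ |f(x)|`, whence `f ≡ λʳ f(x)` is
  constant and `λʳ = 1`; the same at `r + 1` gives `λ = 1`.  (For a reversible `P` the spectrum is
  real and this is literally Lemma 12.1 (i)–(iii); the book's sentence is stated for every
  irreducible aperiodic `P`, and so is the theorem here.)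
* **LEMMA 12.1 (iii)** `LevinPeres2017_lemma_12_1_iii` (complex eigenfunctions),
  `LevinPeres2017_lemma_12_1_iii_real`, `not_hasEigenvalue_neg_one` — **if `P` is irreducible and
  aperiodic, then `−1` is not an eigenvalue of `P`** [cite: LevinPeres2017, §12.1 Lemma 12.1 (iii)];
* `norm_lt_one_of_mem_nontrivialEigenvalues`, **`lambdaStar_lt_one`** (`λ⋆ < 1`),
  **`absSpectralGap_pos`** (`γ⋆ > 0`), `relaxationTime_pos` (`t_rel > 0`)
  [cite: LevinPeres2017, §12.2 p. 163 (`γ⋆ := 1 − λ⋆`; "if `P` is aperiodic and irreducible, then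
  `γ⋆ > 0`")].

Context (cell pub-lqcd, venture LatticeQCDFlow): `t_rel = 1/γ⋆` is finite for every irreducible
aperiodic update — the standing hypothesis under which relaxation-time / autocorrelation figures of
merit of exact samplers are quoted.
-/

namespace Literature.Probability.MarkovChains

open Finset Matrix

variable {X : Type*} [Fintype X] [DecidableEq X]

/-- Powers of a row-stochastic matrix are row-stochastic. [folklore] -/
private theorem isRowStochastic_pow₅ {P : Matrix X X ℝ} (hP : IsRowStochastic P) (n : ℕ) :
    IsRowStochastic (P ^ n) := by
  induction n with
  | zero =>
    refine ⟨fun x y => ?_, fun x => ?_⟩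
    · rw [pow_zero, Matrix.one_apply]
      split_ifs <;> norm_num
    · simp [pow_zero, Matrix.one_apply]
  | succ n ih =>
    refine ⟨fun x y => ?_, fun x => ?_⟩
    · rw [pow_succ, Matrix.mul_apply]
      exact sum_nonneg fun z _ => mul_nonneg (ih.1 x z) (hP.1 z y)
    · simp_rw [pow_succ, Matrix.mul_apply]
      rw [sum_comm]
      calc ∑ z, ∑ y, (P ^ n) x z * P z y = ∑ z, (P ^ n) x z * ∑ y, P z y := by
            simp_rw [mul_sum]
        _ = 1 := by simp_rw [hP.2, mul_one]; exact ih.2 x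

omit [DecidableEq X] in
/-- `Pʳf = λʳf` entrywise: `Σ_y Pʳ(x,y) f(y) = λʳ f(x)` for a complex eigenfunction `Pf = λf`.
[cite: LevinPeres2017, §12.1 (`Pᵗ f_j = λ_jᵗ f_j`, proof of Lemma 12.2)] -/
theorem sum_pow_mul_eigenfunction [DecidableEq X] {P : Matrix X X ℝ} {f : X → ℂ} {lam : ℂ}
    (hf : ∀ x, ∑ y, (P x y : ℂ) * f y = lam * f x) (r : ℕ) :
    ∀ x, ∑ y, (((P ^ r) x y : ℝ) : ℂ) * f y = lam ^ r * f x := by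
  induction r with
  | zero =>
    intro x
    simp only [pow_zero, Matrix.one_apply, one_mul]
    rw [Finset.sum_eq_single x (fun y _ hy => by simp [Ne.symm hy]) (fun h => absurd (mem_univ x) h)]
    simp
  | succ r ih =>
    intro x
    have hentry : ∀ y, (((P ^ (r + 1)) x y : ℝ) : ℂ) = ∑ z, (((P ^ r) x z : ℝ) : ℂ) * (P z y : ℂ) := by
      intro y
      have h : (P ^ (r + 1)) x y = ∑ z, (P ^ r) x z * P z y := by rw [pow_succ, Matrix.mul_apply]
      simp only [h, Complex.ofReal_sum, Complex.ofReal_mul]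
    calc ∑ y, (((P ^ (r + 1)) x y : ℝ) : ℂ) * f y
        = ∑ y, (∑ z, (((P ^ r) x z : ℝ) : ℂ) * (P z y : ℂ)) * f y := by simp_rw [hentry]
      _ = ∑ z, (((P ^ r) x z : ℝ) : ℂ) * ∑ y, (P z y : ℂ) * f y := by
          simp_rw [sum_mul, mul_sum, mul_assoc]; rw [sum_comm]
      _ = ∑ z, (((P ^ r) x z : ℝ) : ℂ) * (lam * f z) := sum_congr rfl fun z _ => by rw [hf z]
      _ = lam * ∑ z, (((P ^ r) x z : ℝ) : ℂ) * f z := by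
          rw [mul_sum]; exact sum_congr rfl fun z _ => by ring
      _ = lam ^ (r + 1) * f x := by rw [ih x]; ring

omit [DecidableEq X] in
/-- Equality case of the maximum-modulus estimate: if the row `Q(x,·)` is a probability vector with
all entries positive, `x` maximises `|f|`, and the average `s = Σ_y Q(x,y) f(y)` has the maximal
modulus `|s| = |f(x)|`, then `f ≡ s`. [cite: LevinPeres2017, §12.1 Lemma 12.1 (i) / Exercise 12.1
(the estimate `|Σ_y P(x,y) f(y)| ≤ Σ_y P(x,y)|f(y)| ≤ max |f|`, here its equality case)] -/
theorem apply_eq_of_norm_sum_eq {Q : Matrix X X ℝ} {x : X} (hQpos : ∀ y, 0 < Q x y)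
    (hQ1 : ∑ y, Q x y = 1) {f : X → ℂ} (hmax : ∀ y, ‖f y‖ ≤ ‖f x‖) {s : ℂ}
    (hs : ∑ y, (Q x y : ℂ) * f y = s) (hnorm : ‖s‖ = ‖f x‖) (y : X) : f y = s := by
  set M := ‖f x‖ with hM
  have hM0 : 0 ≤ M := norm_nonneg _
  -- `Re(conj(s) f(z)) ≤ |s||f(z)| ≤ M²` for every `z`
  have hre_le : ∀ z, (starRingEnd ℂ s * f z).re ≤ M ^ 2 := fun z => by
    calc (starRingEnd ℂ s * f z).re ≤ ‖starRingEnd ℂ s * f z‖ := Complex.re_le_norm _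
      _ = ‖s‖ * ‖f z‖ := by rw [norm_mul, Complex.norm_conj]
      _ ≤ M * M := mul_le_mul hnorm.le (hmax z) (norm_nonneg _) hM0
      _ = M ^ 2 := (sq M).symm
  -- while their `Q(x,·)`-average is `Re(conj(s)·s) = |s|² = M²`
  have h1 : (starRingEnd ℂ s * s).re = M ^ 2 := by
    rw [← hnorm, Complex.mul_re, Complex.conj_re, Complex.conj_im, Complex.sq_norm,
      Complex.normSq_apply]
    ring
  have hsum_re : ∑ z, Q x z * (starRingEnd ℂ s * f z).re = M ^ 2 := by
    have h2 : starRingEnd ℂ s * s = ∑ z, (Q x z : ℂ) * (starRingEnd ℂ s * f z) := by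
      rw [← hs, mul_sum]
      exact sum_congr rfl fun z _ => by ring
    have h3 := congrArg Complex.re h2
    rw [h1, Complex.re_sum] at h3
    simp_rw [Complex.re_ofReal_mul] at h3
    exact h3.symm
  -- so every `Re(conj(s) f(z))` equals `M²`
  have hterm : ∀ z ∈ (univ : Finset X), 0 ≤ Q x z * (M ^ 2 - (starRingEnd ℂ s * f z).re) :=
    fun z _ => mul_nonneg (hQpos z).le (sub_nonneg.mpr (hre_le z))
  have hsum0 : ∑ z, Q x z * (M ^ 2 - (starRingEnd ℂ s * f z).re) = 0 := by
    simp_rw [mul_sub]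
    rw [sum_sub_distrib, ← sum_mul, hQ1, one_mul, hsum_re, sub_self]
  have hre_eq : (starRingEnd ℂ s * f y).re = M ^ 2 := by
    have h0 := (sum_eq_zero_iff_of_nonneg hterm).mp hsum0 y (mem_univ y)
    rcases mul_eq_zero.mp h0 with h | h
    · exact absurd h (hQpos y).ne'
    · linarith
  -- a complex number of modulus `≤ M²` with real part `M²` is `M²`
  have hz : starRingEnd ℂ s * f y = ((M ^ 2 : ℝ) : ℂ) := by
    have hnorm_le : ‖starRingEnd ℂ s * f y‖ ≤ M ^ 2 := by
      rw [norm_mul, Complex.norm_conj, hnorm, sq]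
      exact mul_le_mul_of_nonneg_left (hmax y) hM0
    have him : (starRingEnd ℂ s * f y).im = 0 := by
      have h := Complex.sq_norm (starRingEnd ℂ s * f y)
      rw [Complex.normSq_apply, hre_eq] at h
      have h4 : ‖starRingEnd ℂ s * f y‖ ^ 2 ≤ (M ^ 2) ^ 2 :=
        pow_le_pow_left₀ (norm_nonneg _) hnorm_le 2
      nlinarith [mul_self_nonneg ((starRingEnd ℂ s * f y).im)]
    apply Complex.ext
    · rw [hre_eq, Complex.ofReal_re]
    · rw [him, Complex.ofReal_im]
  -- hence `f(y) = s` (trivially if `M = 0`)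
  by_cases hMz : M = 0
  · have hfy : f y = 0 := by
      have h := hmax y
      rw [hMz] at h
      exact norm_eq_zero.mp (le_antisymm h (norm_nonneg _))
    have hs0 : s = 0 := norm_eq_zero.mp (hnorm.trans hMz)
    rw [hfy, hs0]
  · have hsne : s ≠ 0 := fun h => hMz (by rw [← hnorm, h, norm_zero])
    have hcne : starRingEnd ℂ s ≠ 0 := by simpa using hsne
    have hss : starRingEnd ℂ s * s = ((M ^ 2 : ℝ) : ℂ) := by
      rw [Complex.conj_mul', hnorm]
      push_cast
      ring
    exact mul_left_cancel₀ hcne (hz.trans hss.symm)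

/-- **Every eigenvalue `λ ≠ 1` of an irreducible aperiodic transition matrix has `|λ| < 1`** (so that
`λ⋆ < 1` and `γ⋆ > 0`).  At a maximiser `x` of `|f|` and a power `r` with `Pʳ > 0` entrywise
(Prop. 1.7), `|λ| = 1` gives equality in `|λʳf(x)| ≤ Σ_y Pʳ(x,y)|f(y)| ≤ |f(x)|`, so `f ≡ λʳ f(x)` and
`λʳ = 1`; with `r + 1` in place of `r`, `λ = 1`. [cite: LevinPeres2017, §12.2 p. 163 ("Lemma 12.1
implies that if `P` is aperiodic and irreducible, then `γ⋆ > 0`") with §12.1 Lemma 12.1 (i), (iii)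
and §1.3 Prop. 1.7] -/
theorem norm_lt_one_of_eigenvalue_ne_one {P : Matrix X X ℝ} (hP : IsRowStochastic P)
    (hirr : IsIrreducible P) (hap : IsAperiodic P) {f : X → ℂ} {lam : ℂ}
    (hf : ∀ x, ∑ y, (P x y : ℂ) * f y = lam * f x) (hf0 : f ≠ 0) (hlam : lam ≠ 1) : ‖lam‖ < 1 := by
  refine lt_of_le_of_ne (norm_eigenvalue_le_one hP hf hf0) fun hlam1 => hlam ?_
  obtain ⟨r₀, hr₀⟩ := LevinPeres2017_prop_1_7 hP.1 hirr hap
  obtain ⟨x₁, hx₁⟩ : ∃ x, f x ≠ 0 := Function.ne_iff.mp hf0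
  obtain ⟨x, -, hx⟩ := exists_max_image univ (fun x => ‖f x‖) ⟨x₁, mem_univ _⟩
  have hfx : f x ≠ 0 := by
    intro h
    have h1 : ‖f x₁‖ ≤ ‖f x‖ := hx x₁ (mem_univ _)
    rw [h, norm_zero] at h1
    exact hx₁ (norm_eq_zero.mp (le_antisymm h1 (norm_nonneg _)))
  have key : ∀ r, r₀ ≤ r → lam ^ r = 1 := by
    intro r hr
    have hQ := isRowStochastic_pow₅ hP r
    have h := apply_eq_of_norm_sum_eq (fun y => hr₀ r hr x y) (hQ.2 x)
      (fun y => hx y (mem_univ y)) (sum_pow_mul_eigenfunction hf r x)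
      (by rw [norm_mul, norm_pow, hlam1, one_pow, one_mul]) x
    -- `h : f x = λʳ f x`
    have h2 : (lam ^ r - 1) * f x = 0 := by rw [sub_mul, one_mul, ← h, sub_self]
    exact sub_eq_zero.mp ((mul_eq_zero.mp h2).resolve_right hfx)
  have h1 := key (r₀ + 1) (Nat.le_succ r₀)
  rw [pow_succ, key r₀ le_rfl, one_mul] at h1
  exact h1

/-- **LEMMA 12.1 (iii): if `P` is irreducible and aperiodic, then `−1` is not an eigenvalue of `P`**
— a complex `f` with `Pf = −f` vanishes. [cite: LevinPeres2017, §12.1 Lemma 12.1 (iii)] -/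
theorem LevinPeres2017_lemma_12_1_iii {P : Matrix X X ℝ} (hP : IsRowStochastic P)
    (hirr : IsIrreducible P) (hap : IsAperiodic P) {f : X → ℂ}
    (hf : ∀ x, ∑ y, (P x y : ℂ) * f y = -f x) : f = 0 := by
  by_contra hf0
  have hf' : ∀ x, ∑ y, (P x y : ℂ) * f y = (-1 : ℂ) * f x := fun x => by rw [hf x]; ring
  have h := norm_lt_one_of_eigenvalue_ne_one hP hirr hap hf' hf0 (by norm_num)
  rw [norm_neg, norm_one] at h
  exact lt_irrefl _ h

/-- **LEMMA 12.1 (iii), real form**: for an irreducible aperiodic `P`, `Pf = −f` forces `f = 0`.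
[cite: LevinPeres2017, §12.1 Lemma 12.1 (iii)] -/
theorem LevinPeres2017_lemma_12_1_iii_real {P : Matrix X X ℝ} (hP : IsRowStochastic P)
    (hirr : IsIrreducible P) (hap : IsAperiodic P) {f : X → ℝ} (hf : P *ᵥ f = -f) : f = 0 := by
  have hg : ∀ x, ∑ y, (P x y : ℂ) * ((f y : ℝ) : ℂ) = -((f x : ℝ) : ℂ) := by
    intro x
    have h := congrFun hf x
    rw [mulVec, dotProduct, Pi.neg_apply] at h
    exact_mod_cast h
  have h0 := LevinPeres2017_lemma_12_1_iii hP hirr hap hg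
  funext x
  have h := congrFun h0 x
  simp only [Pi.zero_apply, Complex.ofReal_eq_zero] at h
  rw [Pi.zero_apply]
  exact h

/-- **LEMMA 12.1 (iii), spectral form**: `−1` is not an eigenvalue of the (complexified) transition
matrix of an irreducible aperiodic chain. [cite: LevinPeres2017, §12.1 Lemma 12.1 (iii)] -/
theorem not_hasEigenvalue_neg_one {P : Matrix X X ℝ} (hP : IsRowStochastic P)
    (hirr : IsIrreducible P) (hap : IsAperiodic P) :
    ¬ Module.End.HasEigenvalue (Matrix.toLin' (fun x y => (P x y : ℂ))) (-1) := by
  intro h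
  obtain ⟨f, hf⟩ := h.exists_hasEigenvector
  obtain ⟨hf0, hfx⟩ := (hasEigenvector_iff P f (-1)).mp hf
  exact hf0 (LevinPeres2017_lemma_12_1_iii hP hirr hap fun x => by rw [hfx x]; ring)

/-- Every eigenvalue `λ ≠ 1` of an irreducible aperiodic `P` has `|λ| < 1` (set form).
[cite: LevinPeres2017, §12.2 p. 163 with §12.1 Lemma 12.1] -/
theorem norm_lt_one_of_mem_nontrivialEigenvalues {P : Matrix X X ℝ} (hP : IsRowStochastic P)
    (hirr : IsIrreducible P) (hap : IsAperiodic P) {μ : ℂ} (hμ : μ ∈ nontrivialEigenvalues P) :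
    ‖μ‖ < 1 := by
  obtain ⟨f, hf⟩ := hμ.1.exists_hasEigenvector
  obtain ⟨hf0, hfx⟩ := (hasEigenvector_iff P f μ).mp hf
  exact norm_lt_one_of_eigenvalue_ne_one hP hirr hap hfx hf0 hμ.2

/-- **`λ⋆ < 1` for an irreducible aperiodic chain.** [cite: LevinPeres2017, §12.2 p. 163 (eq. (12.6)
and "Lemma 12.1 implies that if `P` is aperiodic and irreducible, then `γ⋆ > 0`")] -/
theorem lambdaStar_lt_one {P : Matrix X X ℝ} (hP : IsRowStochastic P) (hirr : IsIrreducible P)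
    (hap : IsAperiodic P) : lambdaStar P < 1 := by
  by_cases h : (nontrivialEigenvalues P).Nonempty
  · obtain ⟨μ, hμ, hμeq⟩ := exists_norm_eq_lambdaStar h
    rw [← hμeq]
    exact norm_lt_one_of_mem_nontrivialEigenvalues hP hirr hap hμ
  · unfold lambdaStar
    rw [Set.not_nonempty_iff_eq_empty.mp h, Set.image_empty, Real.sSup_empty]
    exact zero_lt_one

/-- **`γ⋆ > 0`: "if `P` is aperiodic and irreducible, then `γ⋆ > 0`."**
[cite: LevinPeres2017, §12.2 p. 163] -/
theorem absSpectralGap_pos {P : Matrix X X ℝ} (hP : IsRowStochastic P) (hirr : IsIrreducible P)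
    (hap : IsAperiodic P) : 0 < absSpectralGap P :=
  sub_pos.mpr (lambdaStar_lt_one hP hirr hap)

/-- `t_rel = 1/γ⋆ > 0` (finite and positive) for an irreducible aperiodic chain.
[cite: LevinPeres2017, §12.2 p. 163 (definition of `t_rel`, `γ⋆ > 0`)] -/
theorem relaxationTime_pos {P : Matrix X X ℝ} (hP : IsRowStochastic P) (hirr : IsIrreducible P)
    (hap : IsAperiodic P) : 0 < relaxationTime P := by
  unfold relaxationTime
  exact one_div_pos.mpr (absSpectralGap_pos hP hirr hap)

end Literature.Probability.MarkovChains
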